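import Literature.MathematicalPhysics.QuantumFieldTheory.Balaban1983to89.B13Factor210

/-!
# `Balaban1983to89.B13Factor210Literal` — the LITERAL, two-scale admissibility condition of (2.9) in T. Bałaban,
*Renormalization group approach to lattice gauge field theories. II. Cluster expansions*, Commun. Math. Phys.
**116**, 1–22 (1988), doi:10.1007/bf01239022 [Balaban1988RG2Cluster] (cell paper B13 = [II]; PDF held
`paper:balaban1988-cmp116-rg-ii-cluster`, journal page = PDF page), pp. 13–14, IS LOCAL over ζ-compatible pieces
— kernel-checked; this closes clause (4) of cell `GAPS.md` C-B13-18 left open by the sibling module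
`…Balaban1983to89.B13Factor210` (unit `b2b-balaban-b13-g8`; cell rows `GAPS.md` C-B13-21, `DIVERGENCE.md` D-b13.17).

CITATION HEADER (lean-in-tree rule 2026-08-18; every quotation below was read by the typist on the x2 page renders
`b2b-balaban-ref1/pages/1988-cmp116-rg-II-cluster/1988-cmp116-rg-II-cluster-p013-x2.png`, `…-p014-x2.png` and
`b2b-balaban-ref1/pages/1987-cmp109-rg-I-small-field/1987-cmp109-rg-I-small-field-p009-x2.png`, as images, in
this unit).  [II] p. 13 [PDF 13]: *"There is a difference in comparison with the construction of Sect. 1, we take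
cubes from π_{k+1}, i.e. cubes of the size LM in the scale corresponding to the lattice T_η. We define σ₀ as the
family of such cubes Δ disjoint with the interior of Z̃₀, or with the interior of Z′₀, where Z′₀ is a union of the
smallest family of such cubes containing Z̃₀."* and, same page, *"(let us notice the inconsistency in the
notation, the tilde over X₀ means that M₁-cubes are adjoined, and the tilde over Z₀ concerns M-cubes)"*.  [II]
p. 14 [PDF 14]: display (2.8) sums `Σ_Z` of the products `Π_{Δ⊂Z∖Z̃′₀} ∫₀¹ ds(Δ) ∂/∂s(Δ) (…)` — so printed,
with a tilde AND a prime on `Z₀`; `Z̃′₀` is not defined in [II] and is read as `Z′₀`, the only reading under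
which the cubes `Δ` belong to `σ₀` (cell `GAPS.md` G-adv4-24 (a), `DIVERGENCE.md` D-adv5.3: a recorded print slip,
no mathematical content) — followed by *"The sums are over Z such, that each connected component of Z contains a
component of Z′₀. The equalities (2.4), (2.6), (2.8) imply (2.1) = Σ_Z H(Z), where"*
`H(Z) = Σ_{Z₀: Z̃₀⊂Z} H(Z, Z₀).`  (2.9)  *"… From the definition of H(Z) it is also clear, that if
Z = Z₁ ∪ … ∪ Z_n, where Z_i is a connected component of Z, then"*  `H(Z) = H(Z₁) … H(Z_n).`  (2.10), and
*"the function ζ(Z, Z′) is defined by the condition: ζ(Z, Z′) = 0 if Z ∩ Z′ contains a cube, or a wall of a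
cube, and ζ(Z, Z′) = 1 otherwise."*  [I] = T. Bałaban, Commun. Math. Phys. **109**, 249–301 (1987)
[Balaban1987RG1], p. 257 [PDF 9]: *"For a cube □ ∈ π_j and n = 1, 2, … we define □̃ⁿ as a cube of the size
(1 + 2n)M and with a center at the center of □."*, *"Such a domain is a union of a connected, finite family of
cubes from π_j. A connected family means that for every pair □, □′ of cubes from the family there exists a
sequence □, □₁, …, □ₙ, □′ of cubes belonging to the family and such that two consecutive cubes have a common
wall, i.e. their intersection is a d − 1-dimensional cube."* and *"The meaning of the symbol X̃ⁿ should be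
obvious."*  The connected families are typed in `…Balaban1983to89.B14Components` (`Touching`, `WallAdjacent`,
`WConn`, `wComp`), the touching-enlargement `□ ↦ □̃ = □̃¹`, `X ↦ X̃` at index level is `ienl` of
`…Balaban1983to89.B14BoxFix`, boxes `ibox` and their wall-connectedness `ibox_wconn` are in
`…Balaban1983to89.B14BoxFixWall`, the parent-cube map `cubeIdx` and the bond lemma `bond_cubes` in
`…Balaban1983to89.B14DomainGeom` / `…B14Components`, and ζ-compatibility `WallSeparated`, `WallConnected`,
`wComp_union_left/right`, `comp_contains_comp_iff`, `sum_powerset_union` in the sibling `…B13Factor210` — all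
imported, none duplicated.

THE QUESTION (cell `GAPS.md` C-B13-18 clause (4), unit `b2b-balaban-b13-g7`): the sibling module proved the
skeleton (2.9) ⇒ (2.10) under the hypothesis SHAPE `AdmLocal adm` (admissibility local over ζ-compatible pieces)
and discharged that shape only for a MODEL predicate `admMeets` which drops the enlargements `Z₀ ⊆ Z̃₀ ⊆ Z′₀`;
the cell row records the worry that an enlargement by cubes at sup-distance `≤ r` is, in general, local over
pieces only if the pieces are `> 2r` apart, which ζ-compatibility (distance ≥ one wall) does not give, and leaves
open whether the LITERAL condition — «Z̃₀ ⊂ Z» with `Z̃₀ = Z₀` with the touching M-cubes adjoined, `Z′₀` = the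
π_{k+1}-cubes covering `Z̃₀`, plus «each connected component of Z contains a component of Z′₀» — is local.  IT IS, and the reason is a
small geometric fact proved here (`zprime_subset_piece`): the parents (π_{k+1}-cubes) of the full touching box
`□̃` of ONE π_k-cube `□` form a WALL-CONNECTED family (`wallConnected_zprime_singleton`: the box is wall-connected
and the parent map sends wall-adjacent cubes to equal or wall-adjacent cubes, `cubeIdx_wallAdjacent`), which
contains the parent of `□`; so if `□ ⊂ Z₁` and `Z′₀ ⊆ Z₁ ∪ Z₂` with `ζ(Z₁, Z₂) = 1`, that family lies in ONE
piece (input (a) of G-adv4-23, `WallConnected.subset_wComp` + `wComp_union_left`), namely `Z₁`.  Corner-touching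
π_{k+1}-pieces therefore never capture a parent of `Z̃₀` across the corner WITHOUT also violating «Z̃₀ ⊂ Z» — the
worry recorded in C-B13-18 (4) does not materialize, for every `d` and every `L ≥ 1`.

WHAT IS REPRODUCED (all at index level, two scales; MODEL conventions m1–m6 of cell `DIVERGENCE.md` D-b13.17).
(m1) π_k-cubes (side `M`) ↦ indices `x : Pt d = Fin d → ℤ` (universal cover, as in the sibling and in
`…B14Components`); (m2) π_{k+1}-cubes (side `LM`) ↦ indices `b : Pt d`, the π_{k+1}-cube `b` being the union of
the `L^d` π_k-cubes `x` with `⌊x_i / L⌋ = b_i`, i.e. `cubeIdx L x = b` (nested partitions; `fineCubes`,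
`mem_fineCubes`); (m3) `Z̃₀ = ienl ↑Z₀` (a π_k-cube is adjoined iff it touches a cube of `Z₀`: `□̃ = □̃¹`, the
cube of size `(1+2)M` around `□`, [I] p. 257, read at index level as the `3^d` indices at sup-distance ≤ 1,
`ienl_singleton`); (m4) `Z′₀ = zprime L Z₀ := cubeIdx L '' ienl ↑Z₀` (the π_{k+1}-cubes containing a cube of
`Z̃₀` = *"the smallest family of such cubes containing Z̃₀"*); (m5) for a family `Z` of π_{k+1}-cubes, «Z̃₀ ⊂ Z»
is `Z′₀ ⊆ Z` (`ztilde_sub_iff`: every cube of `Z̃₀` lies in a π_{k+1}-cube of `Z` iff every π_{k+1}-cube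
containing a cube of `Z̃₀` is in `Z`); (m6) "connected component" = wall-component `wComp` ([I] p. 257), and «each
connected component of Z contains a component of Z′₀» = `∀ a ∈ Z, ∃ b ∈ Z′₀, wComp Z′₀ b ⊆ wComp Z a`
(equivalently, given `Z′₀ ⊆ Z`, every wall-component of `Z` MEETS `Z′₀`: `admLit_iff_meets`, by the sibling's
`comp_contains_comp_iff`).  With these: `AdmLit L Z Z₀` is the literal admissibility predicate of (2.9);
`admLit_union_iff` is its LOCALITY over ζ-compatible pieces (for `ζ(Z₁,Z₂) = 1` and `Wᵢ` families of π_k-cubes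
inside `Zᵢ`: `AdmLit L (Z₁ ∪ Z₂) (W₁ ∪ W₂) ↔ AdmLit L Z₁ W₁ ∧ AdmLit L Z₂ W₂`); `HsumLit L act Z :=
Σ_{W ⊆ fineCubes L Z, AdmLit L Z W} act Z W` is the two-scale shape of (2.9) (sum over the admissible families
`Z₀` of π_k-cubes inside `Z`), and `HsumLit_union` / `HsumLit_biUnion` give (2.10):
`HsumLit (Z₁ ∪ Z₂) = HsumLit Z₁ * HsumLit Z₂` for ζ-compatible pieces and the product over any finite pairwise
ζ-compatible family (normalization `HsumLit ∅ = act ∅ ∅`, `HsumLit_empty`), GIVEN ONLY the multiplicativity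
shape `ActMulLit L act` of the localized activity (input (c) of G-adv4-23, block-diagonality, together with (b),
s-locality — by reference to [13] = B9 Sect. C in print; hypotheses here, exactly as in the sibling).

NOT ASSERTED.  Nothing printed in [II] is asserted and nothing of the series enters as a hypothesis: the module
proves index-level combinatorial geometry ([folklore]) and the implication `ActMulLit ⇒ (2.10)` for the literal
admissibility predicate.  Whether the paper's localized activity `H(Z, Z₀)` ((2.4)–(2.8): a Gaussian fluctuation
integral with s-interpolated propagators) satisfies `ActMulLit` — inputs (b) s-locality and (c) block-diagonality of
`Δ_k(s)`, `C^{(k)}(Z₀, s)`, `(C^{(k)})^{1/2}(s)` over ζ-separated components — is NOT decided here (cell `GAPS.md`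
G-adv4-23 (b), (c), by reference to [13] Sect. C); the torus identification of indices, the restriction of `Z₀`
to the domains actually produced by (2.1)–(2.4) (p. 12: `Z₀` = *"the smallest localization domain Z₀ ∈ 𝐃_k
containing Y₀ and P"* — any such further constraint on the range of `Z₀` is absorbed in the abstract activity,
`act Z W := 0` off the range, and is then part of the hypothesis `ActMulLit`), and the convention
`H(Z, Z₀) := 0` for `Z` not of the form `Z′₀ ∪ ⋃σ` (cell `GAPS.md` G-adv4-24 (b)) are not modelled.  The
manuscript is under adjudication by the audit cell `pub-balaban`; programme-internal claims are not cited; cell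
rows are named only as locators of readings.  Staged byte-identically in the cell package
`run/shared/lean/pub/pub-balaban/lean/BalabanYm4/Literature/…/B13Factor210Literal.lean`.
-/

namespace Literature.MathematicalPhysics.QuantumFieldTheory.Balaban1983to89.B13Factor210Literal

open Literature.MathematicalPhysics.QuantumFieldTheory.Balaban1983to89.B14DomainGeom
open Literature.MathematicalPhysics.QuantumFieldTheory.Balaban1983to89.B14Components
open Literature.MathematicalPhysics.QuantumFieldTheory.Balaban1983to89.B14BoxFix
open Literature.MathematicalPhysics.QuantumFieldTheory.Balaban1983to89.B14BoxFixWall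
open Literature.MathematicalPhysics.QuantumFieldTheory.Balaban1983to89.B13Factor210

variable {d : ℕ}

/-! ## Part A. Two scales: the parent map `cubeIdx L` preserves wall-chains -/

section TwoScales

variable {L : ℕ}

/-- Wall-adjacent π_k-cubes lie in EQUAL or WALL-ADJACENT π_{k+1}-cubes (`L ≥ 1`; from `bond_cubes`: crossing one
wall of the fine partition crosses at most one wall of the coarse one, in the same direction). [folklore] -/
theorem cubeIdx_wallAdjacent (hL : 0 < L) {x y : Pt d} (h : WallAdjacent x y) :
    cubeIdx L x = cubeIdx L y ∨ WallAdjacent (cubeIdx L x) (cubeIdx L y) := by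
  obtain ⟨i, hi, hrest⟩ := h
  have hcases : y i = x i + 1 ∨ x i = y i + 1 := by
    rcases (abs_eq (show (0 : ℤ) ≤ 1 by norm_num)).mp hi with h1 | h1
    · right; linarith
    · left; linarith
  rcases hcases with h1 | h1
  · have hy : y = x + Pi.single i 1 := by
      funext j
      by_cases hj : j = i
      · subst hj; simp [h1]
      · rw [Pi.add_apply, Pi.single_eq_of_ne hj, add_zero]; exact (hrest j hj).symm
    rw [hy]
    rcases bond_cubes hL x i with h | h
    · exact Or.inl h.symm
    · exact Or.inr h
  · have hx : x = y + Pi.single i 1 := by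
      funext j
      by_cases hj : j = i
      · subst hj; simp [h1]
      · rw [Pi.add_apply, Pi.single_eq_of_ne hj, add_zero]; exact hrest j hj
    rw [hx]
    rcases bond_cubes hL y i with h | h
    · exact Or.inl h
    · exact Or.inr h.symm

/-- A wall-chain of π_k-cubes inside `S` maps to a wall-chain of π_{k+1}-cubes inside the family of parents of `S`.
[folklore] -/
theorem wconn_map_cubeIdx (hL : 0 < L) {S : Set (Pt d)} {a b : Pt d} (h : WConn S a b) :
    WConn (cubeIdx L '' S) (cubeIdx L a) (cubeIdx L b) := by
  induction h with
  | refl => exact Relation.ReflTransGen.refl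
  | tail _ hstep ih =>
    obtain ⟨hbS, hcS, hadj⟩ := hstep
    rcases cubeIdx_wallAdjacent hL hadj with h | h
    · rw [← h]; exact ih
    · exact Relation.ReflTransGen.tail ih ⟨⟨_, hbS, rfl⟩, ⟨_, hcS, rfl⟩, h⟩

/-- The parents of a wall-connected family of π_k-cubes form a wall-connected family of π_{k+1}-cubes. [folklore] -/
theorem wallConnected_image_cubeIdx (hL : 0 < L) {S : Set (Pt d)} (hS : WallConnected S) :
    WallConnected (cubeIdx L '' S) := by
  rintro _ ⟨a, ha, rfl⟩ _ ⟨b, hb, rfl⟩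
  exact wconn_map_cubeIdx hL (hS a ha b hb)

/-- A box of cubes is a wall-connected family (`ibox_wconn` of `…B14BoxFixWall`). [folklore] -/
theorem wallConnected_ibox (lo hi : Pt d) : WallConnected (ibox lo hi) :=
  fun _ ha _ hb => ibox_wconn ha hb

end TwoScales

/-! ## Part B. The enlargements `Z̃₀` (touching π_k-cubes adjoined) and `Z′₀` (covering π_{k+1}-cubes) -/

section Enlargements

/-- [folklore] -/
theorem ienl_mono {A B : Set (Pt d)} (h : A ⊆ B) : ienl A ⊆ ienl B :=
  fun _ ⟨r, hr, hcr⟩ => ⟨r, h hr, hcr⟩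

/-- `X ⊆ X̃` (a cube touches itself). [folklore] -/
theorem subset_ienl (A : Set (Pt d)) : A ⊆ ienl A := fun c hc => ⟨c, hc, Touching.refl c⟩

/-- The touching-enlargement of a union is the union of the enlargements. [folklore] -/
theorem ienl_union (A B : Set (Pt d)) : ienl (A ∪ B) = ienl A ∪ ienl B := by
  ext c
  simp only [ienl, Set.mem_setOf_eq, Set.mem_union]
  constructor
  · rintro ⟨r, hr | hr, hcr⟩
    · exact Or.inl ⟨r, hr, hcr⟩
    · exact Or.inr ⟨r, hr, hcr⟩
  · rintro (⟨r, hr, hcr⟩ | ⟨r, hr, hcr⟩)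
    · exact ⟨r, Or.inl hr, hcr⟩
    · exact ⟨r, Or.inr hr, hcr⟩

/-- `□̃ = □̃¹`, *"a cube of the size (1 + 2n)M and with a center at the center of □"* for `n = 1` ([I] p. 257), at
index level: the `3^d` indices at sup-distance `≤ 1` from `x`, i.e. the box `[x − 𝟙, x + 𝟙]`.
[cite: Balaban1987RG1, p.257] -/
theorem ienl_singleton (x : Pt d) :
    ienl ({x} : Set (Pt d)) = ibox (fun i => x i - 1) (fun i => x i + 1) := by
  ext c
  simp only [ienl, Set.mem_setOf_eq, Set.mem_singleton_iff, exists_eq_left, ibox, Touching]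
  refine forall_congr' fun i => ?_
  rw [abs_sub_le_iff]
  constructor
  · rintro ⟨h1, h2⟩; constructor <;> linarith
  · rintro ⟨h1, h2⟩; constructor <;> linarith

variable (L : ℕ)

/-- `Z′₀` at index level: the π_{k+1}-cubes containing a π_k-cube of `Z̃₀ = ienl ↑Z₀` — *"Z′₀ is a union of the
smallest family of such cubes containing Z̃₀"* ([II] p. 13), the "such cubes" being the cubes of π_{k+1} of the
size `LM`; `cubeIdx L x` is the π_{k+1}-cube of the π_k-cube `x` (model convention m2, m4 of the module docstring).
[cite: Balaban1988RG2Cluster, p.13] -/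
def zprime (Z₀ : Finset (Pt d)) : Set (Pt d) := cubeIdx L '' ienl (↑Z₀ : Set (Pt d))

/-- [folklore] -/
theorem zprime_mono {W W' : Finset (Pt d)} (h : W ⊆ W') : zprime L W ⊆ zprime L W' :=
  Set.image_mono (ienl_mono (Finset.coe_subset.mpr h))

/-- `Z′₀` of a union is the union. [folklore] -/
theorem zprime_union (W₁ W₂ : Finset (Pt d)) : zprime L (W₁ ∪ W₂) = zprime L W₁ ∪ zprime L W₂ := by
  unfold zprime
  rw [Finset.coe_union, ienl_union, Set.image_union]

/-- [folklore] -/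
theorem zprime_empty : zprime L (∅ : Finset (Pt d)) = ∅ := by
  unfold zprime
  rw [Finset.coe_empty, Set.image_eq_empty]
  ext c
  simp [ienl]

/-- The π_{k+1}-cube of a cube of `Z₀` belongs to `Z′₀` (`Z₀ ⊆ Z̃₀ ⊆ Z′₀`). [folklore] -/
theorem parent_mem_zprime {W : Finset (Pt d)} {x : Pt d} (hx : x ∈ W) : cubeIdx L x ∈ zprime L W :=
  ⟨x, subset_ienl _ (Finset.mem_coe.mpr hx), rfl⟩

/-- Model convention m5: for a family `Z` of π_{k+1}-cubes, «Z̃₀ ⊂ Z» (every π_k-cube of `Z̃₀` lies in a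
π_{k+1}-cube of `Z`) is the same as `Z′₀ ⊆ Z`. [cite: Balaban1988RG2Cluster, p.14, (2.9)] -/
theorem ztilde_sub_iff (Z : Set (Pt d)) (Z₀ : Finset (Pt d)) :
    (∀ y ∈ ienl (↑Z₀ : Set (Pt d)), cubeIdx L y ∈ Z) ↔ zprime L Z₀ ⊆ Z := by
  unfold zprime
  rw [Set.image_subset_iff]
  exact Iff.rfl

variable {L}

/-- The π_{k+1}-cubes meeting the touching box `□̃` of ONE π_k-cube `□` form a WALL-CONNECTED family (the image of
the wall-connected box `[x − 𝟙, x + 𝟙]` under the parent map). [folklore] -/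
theorem wallConnected_zprime_singleton (hL : 0 < L) (x : Pt d) :
    WallConnected (zprime L ({x} : Finset (Pt d))) := by
  unfold zprime
  rw [Finset.coe_singleton, ienl_singleton]
  exact wallConnected_image_cubeIdx hL (wallConnected_ibox _ _)

/-- KEY GEOMETRIC FACT.  If the π_k-cubes of `W` lie in π_{k+1}-cubes of `Z₁`, `ζ(Z₁, Z₂) = 1`, and `Z′₀(W)`
lies inside `Z₁ ∪ Z₂`, then `Z′₀(W)` lies inside `Z₁` ALONE: for each cube `x` of `W` the parents of `x̃` form a
wall-connected family through the parent of `x`, which is in `Z₁`, so the family lies in the wall-component of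
`Z₁ ∪ Z₂` through that parent, which is a wall-component of `Z₁` (input (a) of cell `GAPS.md` G-adv4-23:
`WallConnected.subset_wComp`, `wComp_union_left`). [folklore] -/
theorem zprime_subset_piece (hL : 0 < L) {Z₁ Z₂ : Set (Pt d)} (hsep : WallSeparated Z₁ Z₂) {W : Finset (Pt d)}
    (hW : ∀ x ∈ W, cubeIdx L x ∈ Z₁) (hsub : zprime L W ⊆ Z₁ ∪ Z₂) : zprime L W ⊆ Z₁ := by
  rintro c ⟨y, hy, rfl⟩
  obtain ⟨x, hx, hyx⟩ := hy
  have hx' : x ∈ W := Finset.mem_coe.mp hx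
  have hPsub : zprime L ({x} : Finset (Pt d)) ⊆ Z₁ ∪ Z₂ :=
    (zprime_mono L (Finset.singleton_subset_iff.mpr hx')).trans hsub
  have hxP : cubeIdx L x ∈ zprime L ({x} : Finset (Pt d)) :=
    parent_mem_zprime L (Finset.mem_singleton_self x)
  have hP₁ : zprime L ({x} : Finset (Pt d)) ⊆ Z₁ := by
    intro c hc
    have h1 := (wallConnected_zprime_singleton hL x).subset_wComp hPsub hxP hc
    rw [wComp_union_left hsep (hW x hx')] at h1
    exact wComp_subset (hW x hx') h1
  exact hP₁ ⟨y, ⟨x, by simp, hyx⟩, rfl⟩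

end Enlargements

/-! ## Part C. The literal admissibility predicate of (2.9) and its locality -/

section Admissibility

variable (L : ℕ)

/-- THE LITERAL ADMISSIBILITY CONDITION of (2.9), at two scales: `Z₀` (a finite family of π_k-cubes) is admissible
for `Z` (a finite family of π_{k+1}-cubes) iff «Z̃₀ ⊂ Z» — i.e. `Z′₀ ⊆ Z` (m5) — and *"each connected component
of Z contains a component of Z′₀"* (m6).  A DEFINITION modelling the printed range of summation, not a named fact.
[cite: Balaban1988RG2Cluster, p.14, (2.9)] -/
def AdmLit (Z Z₀ : Finset (Pt d)) : Prop :=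
  zprime L Z₀ ⊆ ↑Z ∧ ∀ a ∈ Z, ∃ b ∈ zprime L Z₀, wComp (zprime L Z₀) b ⊆ wComp (↑Z : Set (Pt d)) a

/-- The range condition in local form: given `Z′₀ ⊆ Z`, "every wall-component of `Z` contains a component of `Z′₀`"
iff "every wall-component of `Z` MEETS `Z′₀`" (the sibling's `comp_contains_comp_iff`) — so `AdmLit` is the
sibling's model predicate `admMeets` with the marked family `Z′₀` in place of `Z₀`. [folklore] -/
theorem admLit_iff_meets (Z Z₀ : Finset (Pt d)) :
    AdmLit L Z Z₀ ↔
      zprime L Z₀ ⊆ ↑Z ∧ ∀ a ∈ Z, (wComp (↑Z : Set (Pt d)) a ∩ zprime L Z₀).Nonempty := by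
  constructor
  · rintro ⟨hsub, h⟩
    exact ⟨hsub, fun a ha => (comp_contains_comp_iff hsub a).mp (h a ha)⟩
  · rintro ⟨hsub, h⟩
    exact ⟨hsub, fun a ha => (comp_contains_comp_iff hsub a).mpr (h a ha)⟩

/-- The empty family is admissible for the empty domain (normalization `H(∅) = H(∅, ∅)`). [folklore] -/
theorem admLit_empty : AdmLit L (∅ : Finset (Pt d)) ∅ := by
  refine ⟨?_, fun a ha => ?_⟩
  · rw [zprime_empty]; exact Set.empty_subset _
  · simp at ha

variable {L}

/-- LOCALITY OF THE LITERAL ADMISSIBILITY CONDITION over ζ-compatible pieces (the `AdmLocal` shape of the sibling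
module, inputs (a)+(b) of cell `GAPS.md` G-adv4-23, for the predicate WITH the enlargements `Z₀ ⊆ Z̃₀ ⊆ Z′₀`): for
`ζ(Z₁, Z₂) = 1` and families `W₁, W₂` of π_k-cubes lying in π_{k+1}-cubes of `Z₁`, `Z₂` respectively,
`W₁ ∪ W₂` is admissible for `Z₁ ∪ Z₂` iff each `Wᵢ` is admissible for `Zᵢ`.  The enlargement never crosses to
the other piece: `zprime_subset_piece`. [folklore] -/
theorem admLit_union_iff (hL : 0 < L) {Z₁ Z₂ W₁ W₂ : Finset (Pt d)}
    (hsep : WallSeparated (↑Z₁ : Set (Pt d)) ↑Z₂)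
    (hW₁ : ∀ x ∈ W₁, cubeIdx L x ∈ Z₁) (hW₂ : ∀ x ∈ W₂, cubeIdx L x ∈ Z₂) :
    AdmLit L (Z₁ ∪ Z₂) (W₁ ∪ W₂) ↔ AdmLit L Z₁ W₁ ∧ AdmLit L Z₂ W₂ := by
  have hW₁' : ∀ x ∈ W₁, cubeIdx L x ∈ (↑Z₁ : Set (Pt d)) := fun x hx => Finset.mem_coe.mpr (hW₁ x hx)
  have hW₂' : ∀ x ∈ W₂, cubeIdx L x ∈ (↑Z₂ : Set (Pt d)) := fun x hx => Finset.mem_coe.mpr (hW₂ x hx)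
  unfold AdmLit
  rw [zprime_union, Finset.coe_union]
  constructor
  · rintro ⟨hsub, hcomp⟩
    have hP₁ : zprime L W₁ ⊆ ↑Z₁ :=
      zprime_subset_piece hL hsep hW₁' (Set.subset_union_left.trans hsub)
    have hP₂ : zprime L W₂ ⊆ ↑Z₂ :=
      zprime_subset_piece hL hsep.symm hW₂'
        (Set.subset_union_right.trans (hsub.trans (Set.union_comm _ _).subset))
    have hPsep : WallSeparated (zprime L W₁) (zprime L W₂) := hsep.mono hP₁ hP₂
    refine ⟨⟨hP₁, fun a ha => ?_⟩, ⟨hP₂, fun a ha => ?_⟩⟩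
    · obtain ⟨b, hb, hcont⟩ := hcomp a (Finset.mem_union_left _ ha)
      rw [wComp_union_left hsep (Finset.mem_coe.mpr ha)] at hcont
      have hb₁ : b ∈ zprime L W₁ := by
        rcases hb with hb | hb
        · exact hb
        · exfalso
          have hbZ₁ : b ∈ (↑Z₁ : Set (Pt d)) :=
            wComp_subset (Finset.mem_coe.mpr ha) (hcont (mem_wComp_self _ b))
          exact (hsep b hbZ₁ b (hP₂ hb)).1 rfl
      refine ⟨b, hb₁, ?_⟩
      rw [← wComp_union_left hPsep hb₁]
      exact hcont
    · obtain ⟨b, hb, hcont⟩ := hcomp a (Finset.mem_union_right _ ha)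
      rw [wComp_union_right hsep (Finset.mem_coe.mpr ha)] at hcont
      have hb₂ : b ∈ zprime L W₂ := by
        rcases hb with hb | hb
        · exfalso
          have hbZ₂ : b ∈ (↑Z₂ : Set (Pt d)) :=
            wComp_subset (Finset.mem_coe.mpr ha) (hcont (mem_wComp_self _ b))
          exact (hsep b (hP₁ hb) b hbZ₂).1 rfl
        · exact hb
      refine ⟨b, hb₂, ?_⟩
      rw [← wComp_union_right hPsep hb₂]
      exact hcont
  · rintro ⟨⟨hP₁, hc₁⟩, ⟨hP₂, hc₂⟩⟩
    have hPsep : WallSeparated (zprime L W₁) (zprime L W₂) := hsep.mono hP₁ hP₂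
    refine ⟨Set.union_subset_union hP₁ hP₂, fun a ha => ?_⟩
    rcases Finset.mem_union.mp ha with ha | ha
    · obtain ⟨b, hb, hcont⟩ := hc₁ a ha
      refine ⟨b, Or.inl hb, ?_⟩
      rw [wComp_union_left hPsep hb, wComp_union_left hsep (Finset.mem_coe.mpr ha)]
      exact hcont
    · obtain ⟨b, hb, hcont⟩ := hc₂ a ha
      refine ⟨b, Or.inr hb, ?_⟩
      rw [wComp_union_right hPsep hb, wComp_union_right hsep (Finset.mem_coe.mpr ha)]
      exact hcont

end Admissibility

/-! ## Part D. The two-scale sum (2.9) and the factorization (2.10) -/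

section Sums

variable (L : ℕ)

/-- The π_k-cubes inside the π_{k+1}-cubes of `Z` (model convention m2: the π_{k+1}-cube `b` is the union of the
`L^d` π_k-cubes `x` with `L·b_i ≤ x_i < L·b_i + L`). [folklore] -/
noncomputable def fineCubes (Z : Finset (Pt d)) : Finset (Pt d) :=
  Z.biUnion fun b => Fintype.piFinset fun i => Finset.Ico ((L : ℤ) * b i) ((L : ℤ) * b i + L)

variable {L}

/-- A π_k-cube is inside `Z` iff its π_{k+1}-cube belongs to `Z`. [folklore] -/
theorem mem_fineCubes (hL : 0 < L) {Z : Finset (Pt d)} {x : Pt d} :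
    x ∈ fineCubes L Z ↔ cubeIdx L x ∈ Z := by
  simp only [fineCubes, Finset.mem_biUnion, Fintype.mem_piFinset, Finset.mem_Ico]
  constructor
  · rintro ⟨b, hb, hx⟩
    rwa [cubeIdx_eq_of_mem L hL x b hx]
  · intro h
    exact ⟨cubeIdx L x, h, fun i => ⟨cubeIdx_le L hL x i, lt_cubeIdx L hL x i⟩⟩

/-- [folklore] -/
theorem fineCubes_union (hL : 0 < L) (Z₁ Z₂ : Finset (Pt d)) :
    fineCubes L (Z₁ ∪ Z₂) = fineCubes L Z₁ ∪ fineCubes L Z₂ := by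
  ext x
  simp only [Finset.mem_union, mem_fineCubes hL]

/-- Disjoint families of π_{k+1}-cubes have disjoint families of π_k-cubes. [folklore] -/
theorem disjoint_fineCubes (hL : 0 < L) {Z₁ Z₂ : Finset (Pt d)} (h : Disjoint Z₁ Z₂) :
    Disjoint (fineCubes L Z₁) (fineCubes L Z₂) := by
  rw [Finset.disjoint_left] at h ⊢
  intro x hx₁ hx₂
  rw [mem_fineCubes hL] at hx₁ hx₂
  exact h hx₁ hx₂

/-- [folklore] -/
theorem fineCubes_empty (L : ℕ) : fineCubes L (∅ : Finset (Pt d)) = ∅ := by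
  simp [fineCubes]

variable (L)
variable {R : Type*} [CommSemiring R]

/-- The two-scale shape of (2.9): `H(Z) = Σ_{Z₀: Z̃₀⊂Z} H(Z, Z₀)` — a finite sum over the families `Z₀` of
π_k-cubes inside `Z` satisfying the LITERAL admissibility condition `AdmLit`, of abstract localized activities
`act Z Z₀` (= `H(Z, Z₀)`, the fluctuation integral (2.4)–(2.8), NOT modelled). [cite: Balaban1988RG2Cluster, p.14, (2.9)] -/
noncomputable def HsumLit [∀ Z Z₀ : Finset (Pt d), Decidable (AdmLit L Z Z₀)]
    (act : Finset (Pt d) → Finset (Pt d) → R) (Z : Finset (Pt d)) : R :=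
  ∑ Z₀ ∈ (fineCubes L Z).powerset with AdmLit L Z Z₀, act Z Z₀

/-- MULTIPLICATIVITY of the localized activity over ζ-compatible pieces on admissible arguments — the SHAPE of
inputs (b) s-locality + (c) block-diagonality of cell `GAPS.md` G-adv4-23 at two scales; a HYPOTHESIS shape (a
DEFINITION of a property of the abstract `act`), NOT asserted for the paper's `H(Z, Z₀)`. [folklore] -/
def ActMulLit (act : Finset (Pt d) → Finset (Pt d) → R) : Prop :=
  ∀ Z₁ Z₂ W₁ W₂ : Finset (Pt d), WallSeparated (↑Z₁ : Set (Pt d)) ↑Z₂ →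
    W₁ ⊆ fineCubes L Z₁ → W₂ ⊆ fineCubes L Z₂ → AdmLit L Z₁ W₁ → AdmLit L Z₂ W₂ →
    act (Z₁ ∪ Z₂) (W₁ ∪ W₂) = act Z₁ W₁ * act Z₂ W₂

variable {L}
variable [∀ Z Z₀ : Finset (Pt d), Decidable (AdmLit L Z Z₀)] {act : Finset (Pt d) → Finset (Pt d) → R}

/-- (2.10) FOR TWO ζ-COMPATIBLE PIECES with the LITERAL admissibility condition: `H(Z₁ ∪ Z₂) = H(Z₁) H(Z₂)`, given
only the multiplicativity shape of the activity — locality of admissibility is now a theorem (`admLit_union_iff`),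
the bijection `Z₀ ↦ (Z₀ ∩ Z₁-part, Z₀ ∩ Z₂-part)` is the sibling's `sum_powerset_union` on the π_k-cubes.
[cite: Balaban1988RG2Cluster, p.14, (2.10)] -/
theorem HsumLit_union (hL : 0 < L) (hact : ActMulLit L act) {Z₁ Z₂ : Finset (Pt d)}
    (hsep : WallSeparated (↑Z₁ : Set (Pt d)) ↑Z₂) :
    HsumLit L act (Z₁ ∪ Z₂) = HsumLit L act Z₁ * HsumLit L act Z₂ := by
  have hdisj : Disjoint (fineCubes L Z₁) (fineCubes L Z₂) :=
    disjoint_fineCubes hL (WallSeparated.of_finset hsep)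
  unfold HsumLit
  rw [fineCubes_union hL, Finset.sum_filter, Finset.sum_filter, Finset.sum_filter, sum_powerset_union hdisj,
    Finset.sum_product, Finset.sum_mul_sum]
  refine Finset.sum_congr rfl fun W₁ hW₁ => Finset.sum_congr rfl fun W₂ hW₂ => ?_
  rw [Finset.mem_powerset] at hW₁ hW₂
  have hW₁' : ∀ x ∈ W₁, cubeIdx L x ∈ Z₁ := fun x hx => (mem_fineCubes hL).mp (hW₁ hx)
  have hW₂' : ∀ x ∈ W₂, cubeIdx L x ∈ Z₂ := fun x hx => (mem_fineCubes hL).mp (hW₂ hx)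
  have hloc := admLit_union_iff hL hsep hW₁' hW₂'
  by_cases h₁ : AdmLit L Z₁ W₁
  · by_cases h₂ : AdmLit L Z₂ W₂
    · rw [if_pos (hloc.mpr ⟨h₁, h₂⟩), if_pos h₁, if_pos h₂]
      exact hact Z₁ Z₂ W₁ W₂ hsep hW₁ hW₂ h₁ h₂
    · have h₁₂ : ¬ AdmLit L (Z₁ ∪ Z₂) (W₁ ∪ W₂) := fun h => h₂ (hloc.mp h).2
      rw [if_neg h₁₂, if_neg h₂, mul_zero]
  · have h₁₂ : ¬ AdmLit L (Z₁ ∪ Z₂) (W₁ ∪ W₂) := fun h => h₁ (hloc.mp h).1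
    rw [if_neg h₁₂, if_neg h₁, zero_mul]

/-- The value at the empty domain: `H(∅) = H(∅, ∅)` (the empty family is admissible, `admLit_empty`); so the
normalization `H(∅) = 1` of `HsumLit_biUnion` reads `act ∅ ∅ = 1`. [folklore] -/
theorem HsumLit_empty (act : Finset (Pt d) → Finset (Pt d) → R) : HsumLit L act ∅ = act ∅ ∅ := by
  unfold HsumLit
  rw [Finset.sum_filter, fineCubes_empty, Finset.powerset_empty, Finset.sum_singleton, if_pos (admLit_empty L)]

/-- (2.10) AS PRINTED with the LITERAL admissibility condition: `H(Z) = H(Z₁) … H(Z_n)` for `Z = Z₁ ∪ … ∪ Z_n`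
with the `Z_i` pairwise ζ-compatible (in particular the wall-components of `Z`, `comps_pairwise_wallSeparated` of
the sibling), given the multiplicativity shape of the activity and the normalization `H(∅, ∅) = 1`.
[cite: Balaban1988RG2Cluster, p.14, (2.10)] -/
theorem HsumLit_biUnion {ι : Type*} [DecidableEq ι] (hL : 0 < L) (hact : ActMulLit L act) (h0 : act ∅ ∅ = 1)
    (Z : ι → Finset (Pt d)) (I : Finset ι)
    (hsep : (↑I : Set ι).Pairwise fun i j => WallSeparated (↑(Z i) : Set (Pt d)) ↑(Z j)) :
    HsumLit L act (I.biUnion Z) = ∏ i ∈ I, HsumLit L act (Z i) := by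
  induction I using Finset.induction_on with
  | empty => simpa [HsumLit_empty] using h0
  | insert a I haI ih =>
    have hsep' : (↑I : Set ι).Pairwise fun i j => WallSeparated (↑(Z i) : Set (Pt d)) ↑(Z j) :=
      hsep.mono (Finset.coe_subset.mpr (Finset.subset_insert a I))
    have hsepU : WallSeparated (↑(Z a) : Set (Pt d)) ↑(I.biUnion Z) := by
      rw [Finset.coe_biUnion]
      refine (WallSeparated.iUnion₂_left fun i hi => ?_).symm
      have hi' : i ∈ I := Finset.mem_coe.mp hi
      have hia : i ≠ a := by rintro rfl; exact haI hi'
      exact hsep (Finset.mem_coe.mpr (Finset.mem_insert_of_mem hi'))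
        (Finset.mem_coe.mpr (Finset.mem_insert_self a I)) hia
    rw [Finset.biUnion_insert, Finset.prod_insert haI, HsumLit_union hL hact hsepU, ih hsep']

end Sums

/-! ## Part E. Sanity checks of the two-scale model -/

/-- Sanity check of the model (m3, m4): the touching box of the corner π_k-cube `(1,1)` of the π_{k+1}-cube
`(0,0)` (`d = 2`, `L = 2`) reaches into all four π_{k+1}-cubes around that corner — the phenomenon behind clause
(4) of cell `GAPS.md` C-B13-18 — e.g. into the diagonal one, `(1,1)`. [folklore] -/
example : (![1, 1] : Pt 2) ∈ zprime 2 ({![1, 1]} : Finset (Pt 2)) := by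
  refine ⟨![2, 2], ⟨![1, 1], by simp, fun i => ?_⟩, ?_⟩
  · fin_cases i <;> simp
  · funext i; fin_cases i <;> rfl

/-- … and the parent π_{k+1}-cube `(0,0)` itself is there (`Z₀ ⊆ Z̃₀ ⊆ Z′₀`). [folklore] -/
example : (![0, 0] : Pt 2) ∈ zprime 2 ({![1, 1]} : Finset (Pt 2)) := by
  have h := parent_mem_zprime 2 (Finset.mem_singleton_self (![1, 1] : Pt 2))
  have e : cubeIdx 2 (![1, 1] : Pt 2) = ![0, 0] := by funext i; fin_cases i <;> rfl
  rwa [e] at h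

end Literature.MathematicalPhysics.QuantumFieldTheory.Balaban1983to89.B13Factor210Literal
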